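import Literature.MathematicalPhysics.QuantumFieldTheory.Balaban1983to89.B5Eq120IterProof
import Literature.MathematicalPhysics.QuantumFieldTheory.Balaban1983to89.B9Eq3170
import Literature.MathematicalPhysics.QuantumFieldTheory.BalabanImbrieJaffe1984to88.BIJ85AxialPropagator411
import Literature.MathematicalPhysics.QuantumFieldTheory.BalabanImbrieJaffe1984to88.BIJ85GaugeFunction5113

/-!
# `Balaban1983to89.B5Eq112RenormTransf` — T. Bałaban, *Propagators and renormalization transformations for lattice gauge
theories. I*, Commun. Math. Phys. **95** (1984) 17–40 [Balaban1984PropagatorsI]: the RENORMALIZATION TRANSFORMATION (1.12) p. 19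
`(Te^{−S})(B) = ∫dA δ(B − QA)δ_Ax(A)e^{−S(A)}` on the carriers of record, TYPED at measure level, with the printed gauge-covariance
step of (1.15) PROVED

statement-level skeleton of published theorems with citation tags; proofs where landed; nothing here is a claim about the Yang–Mills mass gap

PDF held: `paper:balaban1984-cmp95-propagators-rt-i` (journal page = PDF page + 16); p. 19 [PDF 3] was read for this file as an image
from the ×2 render `run/shared/lean/pub/pub-balaban/b2b-balaban-ref1/pages/1984-cmp95-propagators-rt-I/1984-cmp95-propagators-rt-I-p003-x2.png`.

PRINT, verbatim (p. 19).  "We still have the invariance with respect to the restricted transformations and we remove it by introducing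
Axial (Ax) gauge fixing conditions `A(Γ_{y,x}) = 0`, `x ∈ B(y)`, `x ≠ y`, `y ∈ T_L^{(1)}`. If we denote
`δ_Ax(A) = Π_{y∈T_L^{(1)}} Π_{x∈B(y), x≠y} δ(A(Γ_{y,x}))`, (1.10)  `(QA)_c = Σ_{x∈B(c₋)} L^{−(d+1)}A([x, x(c)])`, `δ(B − QA) = Π_{c⊂T_L^{(1)}}
δ(B_c − (QA)_c)`, (1.11) then the renormalization transformation `T` is defined by `(Te^{−S})(B) = ∫dA δ(B − QA)δ_Ax(A)e^{−S(A)}`. (1.12)";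
"The integral in (1.12) is obviously a Gaussian integral. We will prove later that the quadratic form `⟨∂A, ∂A⟩` is positive on the subspace
of `A` satisfying `QA = 0`, `A(Γ_{y,x}) = 0`, `x∈B(y)`, `y∈T_L^{(1)}`."; (1.15): "The form `⟨B, Δ₁B⟩` is gauge invariant. If `λ₁` is a gauge
transformation on `T_L^{(1)}`, then defining `λ` on `T₁` as constant on each block, `λ(x) = λ₁(y)` for `x ∈ B(y)`, we have
`Z^{(0)}exp(−½⟨B^{λ₁}, Δ₁B^{λ₁}⟩) = ∫dA δ(B^{λ₁} − QA^λ)δ_Ax(A^λ)exp(−S(A^λ)) = ∫dA δ(B − ∂λ₁ − QA + ∂Q′λ)δ_Ax(A)exp(−S(A))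
= Z^{(0)}exp(−½⟨B, Δ₁B⟩)`. (1.15)" (with (1.9) "`B^λ_c = B_c − L^{−1}(λ(c₊) − λ(c₋)) = B_c − (∂λ)(c)`" and (1.13) "the average field `B`
transforms as `… = B_c − L^{−1}((Q′λ)(c₊) − (Q′λ)(c₋))`. Fixing it we restrict the gauge transformations by the condition `(Q′λ)(y) = 0`.
The remaining gauge degrees of freedom are removed by the term `δ_Ax(A)`.").

CITATION HEADER (lean-in-tree rule) — WHAT IS REPRODUCED.  SKELETON.md row `B5.Eq1.12` ([DEF], ABSENT-RANKED #3, SPARE list of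
PHASE2-TARGETS §G.5-12; fold owner r02), over the carriers OF RECORD of `…Balaban1983to89.LatticeFieldCalculus` (unit r18): the torus
levels `Site P j`/`PBond P j` of `Setup` (centred blocks, `emb`, `Site.blockSite`; DIVERGENCE F3 of `pub-balaban`: the print anchors `B(y)`
and `Γ_{y,x}` at the corner — nothing below depends on the anchor), real bond fields `VecField P j ℝ`, the axial gauge (1.10) `IsAxial`
(staircase sums `stairSum` along `Γ_{y,x}`), the linear average (1.11) `bondAvg`, gauge transformations (1.4) `gaugeShift`, and the covariance
(1.13) `bondAvg_gaugeShift` / the telescoping `B5Eq120IterProof.stairSum_grad` (both PROVED there, used by name).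
Linearity of the constraints ((1.7)/(1.10)/(1.11): `bondAvg_add/_smul/_zero`, `stairSum_add/_smul`, `isAxial_add/_smul/_zero`) is
`BalabanImbrieJaffe1984to88.BIJ85AxialPropagator411` §Linear, and `Q′(λ₁ ∘ blockOf) = λ₁` is
`BalabanImbrieJaffe1984to88.BIJ85GaugeFunction5113.siteAvg_comp_blockOf`, by name (same carriers).
THE TYPED READING of the δ-functions (the reading this cell's B9 lineage uses for every δ of a LINEAR constraint, `B9Eq3166.subInt` /
`B9Eq3170.IsBasisOf`, by name): `δ(B − QA)δ_Ax(A)` restricts `dA` to the AFFINE FIBRE `fibre B = {A : A axial, QA = B}`, a translate of the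
subspace `axialKer = {A : A axial, QA = 0}` (the print's "subspace of A satisfying QA = 0, A(Γ_{y,x}) = 0"); `(Te^{−S})(B)` := the Lebesgue
(surface-measure) integral of `e^{−S}` over that fibre, `B9Eq3166.subInt` in any basis matrix of `axialKer`, based at an explicit axial
representative `faceField B` of the fibre.  NORMALISATION: the print's product of one-dimensional δ's differs from the induced surface measure by
a positive constant depending on `d`, `L`, `|T|` only (a Jacobian of the constraint map), independent of `S` and `B` — it is part of the
constant `Z^{(0)}` of (1.14), which the print never evaluates; recorded, not asserted (same convention as `B9Eq3170`, DIVERGENCE D-b09.58).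
WHAT IS PROVED (kernel, no `sorry`, standard axioms; standing range `j + 1 ≤ m + K` of `Setup.Params` where block geometry enters):
* `axialKer` is a subspace and `IsAxial ∧ QA = B` ⟺ `A − faceField B ∈ axialKer` (`mem_fibre_iff`); **the fibre is never empty**:
  `faceField B` (the field `L·B_c` on the bonds of `B(c₋)` crossing into `B(c₊)`, zero elsewhere) is axial and averages to `B`
  (`isAxial_faceField`, `bondAvg_faceField`) — so (1.12) integrates over a genuine affine subspace for EVERY `B`;
* `renormTransf` does not depend on the basis of `axialKer` (`renormTransf_eq_subInt`) nor on the representative of the fibre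
  (`renormTransf_eq_of_mem_fibre`: translation invariance of Lebesgue measure);
* **(1.15), the integral step**: for every gauge-invariant density `S(A − ∂λ) = S(A)` and every `λ₁` on the coarse lattice,
  `(Te^{−S})(B^{λ₁}) = (Te^{−S})(B)` with `B^{λ₁} = B − ∂λ₁` (coarse lattice factor `c/L`), by the printed change of variables `A ↦ A^λ`,
  `λ = λ₁` block-constant (`renormTransf_gaugeShift`; ingredients `isAxial_gaugeShift_blockConst`, `bondAvg_gaugeShift_blockConst`).
DELIBERATELY NOT HERE: the Gaussian evaluation (1.14) `= Z^{(0)}exp(−½⟨B, Δ₁B⟩)` and the positivity of `⟨∂A, ∂A⟩` on `axialKer` (rows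
B5.Eq1.14 / B5.Claim@19; the Landau-gauge `k`-fold version is `B5Hk164Transl`), the composition law (1.16)–(1.17) (row B5.Eq1.17).

Unit `lit-balaban-p16` (Phase-2 proof seat p16, SPARE target after PHASE2-TARGETS §G.6), HOME `run/shared/lean/pub/lit-balaban/`, 2026-08-21.
-/

open scoped BigOperators

namespace Literature.MathematicalPhysics.QuantumFieldTheory.Balaban1983to89

namespace B5Eq112RenormTransf

open LatticeFieldCalculus MeasureTheory Matrix
open B9Eq3166 (subInt)
open B9Eq3170 (IsBasisOf subInt_eq_of_isBasisOf)
open Literature.MathematicalPhysics.QuantumFieldTheory.BalabanImbrieJaffe1984to88.BIJ85AxialPropagator411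
  (bondAvg_add bondAvg_smul bondAvg_zero isAxial_add isAxial_smul isAxial_zero)
open Literature.MathematicalPhysics.QuantumFieldTheory.BalabanImbrieJaffe1984to88.BIJ85GaugeFunction5113 (siteAvg_comp_blockOf)

/-! ## 1. Linearity of the constraints (1.10), (1.11); the subspace `{QA = 0, A(Γ_{y,x}) = 0}` and the fibres of `δ(B − QA)δ_Ax(A)` -/

section Linear

variable {P : Params} {j : ℕ} {V : Type*} [AddCommGroup V] [Module ℝ V]

/-- `Q(A − A′) = QA − QA′`. [cite: Balaban1984PropagatorsI, (1.11) p.19] -/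
theorem bondAvg_sub (A B : VecField P j V) : bondAvg (fun b => A b - B b) = bondAvg A - bondAvg B := by
  funext c
  simp only [bondAvg, segSum, Pi.sub_apply, Finset.sum_sub_distrib, smul_sub]

omit [Module ℝ V] in
/-- The axial gauge (1.10) asks `A(Γ_{y,x}) = 0` for `x ≠ y` only because `Γ_{y,y}` is empty: equivalently for ALL block points.
[cite: Balaban1984PropagatorsI, (1.10) p.19] -/
theorem isAxial_iff_forall (A : VecField P j V) :
    IsAxial A ↔ ∀ (y : Site P (j + 1)) (r : Fin P.d → Fin P.L), stairSum A (emb y) (Site.blockSite y r) = 0 := by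
  refine ⟨fun h y r => ?_, fun h y r _ => h y r⟩
  by_cases hc : Site.blockSite y r = emb y
  · rw [hc, stairSum_self]
  · exact h y r hc

/-- **"The subspace of `A` satisfying `QA = 0`, `A(Γ_{y,x}) = 0`, `x∈B(y)`, `y∈T_L^{(1)}`"** (p. 19, after (1.13)): the common
null space of the constraints (1.10)–(1.11) — the direction space of every fibre of `δ(B − QA)δ_Ax(A)`.
[cite: Balaban1984PropagatorsI, (1.12) p.19] -/
def axialKer (P : Params) (j : ℕ) (V : Type*) [AddCommGroup V] [Module ℝ V] : Submodule ℝ (VecField P j V) where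
  carrier := {A | IsAxial A ∧ bondAvg A = 0}
  zero_mem' := ⟨isAxial_zero, bondAvg_zero⟩
  add_mem' := by
    rintro A B ⟨hA, hA'⟩ ⟨hB, hB'⟩
    exact ⟨isAxial_add hA hB, by rw [bondAvg_add, hA', hB', add_zero]⟩
  smul_mem' := by
    rintro a A ⟨hA, hA'⟩
    exact ⟨isAxial_smul a hA, by rw [bondAvg_smul, hA', smul_zero]⟩

/-- Membership in the constraint subspace, unfolded. [cite: Balaban1984PropagatorsI, (1.12) p.19] -/
theorem mem_axialKer_iff (A : VecField P j V) : A ∈ axialKer P j V ↔ IsAxial A ∧ bondAvg A = 0 := Iff.rfl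

/-- **The support of `δ(B − QA)δ_Ax(A)`** in (1.12): the set of axial configurations averaging to the prescribed coarse field `B`
(`δ(B − QA) = Π_c δ(B_c − (QA)_c)`, `δ_Ax(A) = Π δ(A(Γ_{y,x}))`). [cite: Balaban1984PropagatorsI, (1.12) p.19] -/
def fibre (B : VecField P (j + 1) V) : Set (VecField P j V) := {A | IsAxial A ∧ bondAvg A = B}

/-- Membership in the fibre, unfolded. [cite: Balaban1984PropagatorsI, (1.12) p.19] -/
theorem mem_fibre (B : VecField P (j + 1) V) (A : VecField P j V) : A ∈ fibre B ↔ IsAxial A ∧ bondAvg A = B := Iff.rfl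

/-- Two points of one fibre differ by an element of the constraint subspace (the constraints are linear): if `A₀ ∈ fibre B` then
`A ∈ fibre B ↔ A − A₀ ∈ axialKer`. [cite: Balaban1984PropagatorsI, (1.12) p.19] -/
theorem mem_fibre_iff_sub_mem {B : VecField P (j + 1) V} {A₀ : VecField P j V} (h₀ : A₀ ∈ fibre B) (A : VecField P j V) :
    A ∈ fibre B ↔ A - A₀ ∈ axialKer P j V := by
  obtain ⟨h₁, h₂⟩ := (mem_fibre B A₀).mp h₀
  rw [isAxial_iff_forall] at h₁
  have hAA : A - A₀ = fun b => A b - A₀ b := rfl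
  rw [mem_fibre, isAxial_iff_forall, mem_axialKer_iff, isAxial_iff_forall, hAA, bondAvg_sub, h₂, sub_eq_zero]
  simp only [B5Eq120IterProof.stairSum_sub, h₁, sub_zero]

end Linear

/-! ## 2. The fibre is never empty: an explicit axial representative -/

section Representative

variable {P : Params} {j : ℕ} {V : Type*} [AddCommGroup V] [Module ℝ V]

/-- An explicit point of the fibre over `B`: the bond field equal to `L·B_c` on the bonds `⟨z, z + e_μ⟩` of `B(c₋)` whose source `z`
lies on the far face of its block in the direction `μ` (label `≡ L − 1 (mod L)`) — the unique bond of each straight contour `[x, x(c)]`,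
`x ∈ B(c₋)`, crossing from `B(c₋)` into `B(c₊)` — and `0` on all other bonds (no staircase `Γ_{y,x}` inside a block meets such a bond).
[cite: Balaban1984PropagatorsI, (1.12) p.19] -/
def faceField (B : VecField P (j + 1) V) : VecField P j V :=
  fun b => if (b.src b.dir).val % P.L = P.L - 1 then (P.L : ℝ) • B ⟨blockOf b.src, b.dir⟩ else 0

/-- `faceField` vanishes off the far faces. [folklore] -/
private theorem faceField_of_ne (B : VecField P (j + 1) V) (z : Site P j) (μ : Fin P.d) (h : (z μ).val % P.L ≠ P.L - 1) :
    faceField B ⟨z, μ⟩ = 0 := by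
  simp only [faceField, if_neg h]

/-- `L ∣ sitesPerDir j` in the standing range (`N_j = N_{j+1}·L`). [folklore] -/
private theorem L_dvd_sitesPerDir (hj : j + 1 ≤ P.m + P.K) : P.L ∣ P.sitesPerDir j :=
  ⟨P.sitesPerDir (j + 1), by rw [P.sitesPerDir_eq_mul_succ hj, mul_comm]⟩

/-- `2L ≤ sitesPerDir j` in the standing range. [folklore] -/
private theorem two_mul_L_le_sitesPerDir (hj : j + 1 ≤ P.m + P.K) : 2 * P.L ≤ P.sitesPerDir j := by
  rw [P.sitesPerDir_eq_mul_succ hj]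
  exact Nat.mul_le_mul_right _ (P.one_lt_sitesPerDir (j + 1))

/-- The label of the `t`-th site of the straight contour from the block point `x = (y, r)`: offset `r_μ + t` modulo `L`.
[folklore] -/
private theorem val_runSite_blockSite_mod (hj : j + 1 ≤ P.m + P.K) (y : Site P (j + 1)) (r : Fin P.d → Fin P.L) (μ : Fin P.d)
    (t : ℕ) : ((runSite (Site.blockSite y r) μ t) μ).val % P.L = ((r μ : ℕ) + t) % P.L := by
  simp only [runSite, Function.update_self, Site.blockSite]
  rw [← Nat.cast_add, ZMod.val_natCast, Nat.mod_mod_of_dvd _ (L_dvd_sitesPerDir hj), add_assoc, add_comm, Nat.add_mul_mod_self_right]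

omit [Module ℝ V] in
/-- Moving `t < L − r_μ` steps in the direction `μ` inside the block changes only the offset. [folklore] -/
private theorem runSite_blockSite_of_lt (y : Site P (j + 1)) (r : Fin P.d → Fin P.L) (μ : Fin P.d) (t : ℕ)
    (h : (r μ : ℕ) + t < P.L) :
    runSite (Site.blockSite y r) μ t = Site.blockSite y (Function.update r μ ⟨r μ + t, h⟩) := by
  funext ν
  by_cases hν : ν = μ
  · subst hν
    simp only [runSite, Function.update_self, Site.blockSite]
    push_cast
    ring
  · simp only [runSite, Function.update_of_ne hν, Site.blockSite]

/-- **`Q(faceField B) = B`**: each straight contour `[x, x(c)]`, `x ∈ B(c₋)`, contains exactly one far-face bond of `B(c₋)`, carrying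
`L·B_c`, so `(Q faceField B)_c = Σ_{x∈B(c₋)} L^{−(d+1)}·L·B_c = B_c`. [cite: Balaban1984PropagatorsI, (1.11) p.19] -/
theorem bondAvg_faceField (hj : j + 1 ≤ P.m + P.K) (B : VecField P (j + 1) V) : bondAvg (faceField B) = B := by
  funext c
  have hL : 1 < P.L := P.hL.2
  -- every straight contour contributes `L·B_c`
  have hseg : ∀ r : Fin P.d → Fin P.L, segSum (faceField B) (Site.blockSite c.src r) c.dir P.L = (P.L : ℝ) • B c := by
    intro r
    have ht₀ : P.L - 1 - (r c.dir : ℕ) < P.L := by omega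
    rw [segSum, Finset.sum_eq_single_of_mem (P.L - 1 - (r c.dir : ℕ)) (Finset.mem_range.mpr ht₀)]
    · -- the face bond
      have hlt : (r c.dir : ℕ) + (P.L - 1 - (r c.dir : ℕ)) < P.L := by have := (r c.dir).isLt; omega
      have hface : ((runSite (Site.blockSite c.src r) c.dir (P.L - 1 - (r c.dir : ℕ))) c.dir).val % P.L = P.L - 1 := by
        rw [val_runSite_blockSite_mod hj, Nat.mod_eq_of_lt hlt]; have := (r c.dir).isLt; omega
      simp only [runBond, faceField, if_pos hface]
      rw [runSite_blockSite_of_lt _ _ _ _ hlt, Site.blockOf_blockSite hj]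
    · -- all other bonds of the contour are off the far faces
      intro t ht hne
      rw [Finset.mem_range] at ht
      apply faceField_of_ne
      rw [val_runSite_blockSite_mod hj]
      have hr := (r c.dir).isLt
      rcases lt_or_ge ((r c.dir : ℕ) + t) P.L with h | h
      · rw [Nat.mod_eq_of_lt h]; omega
      · rw [Nat.mod_eq_sub_mod h, Nat.mod_eq_of_lt (by omega)]; omega
  simp only [bondAvg, hseg, Finset.sum_const, Finset.card_univ, Fintype.card_fun, Fintype.card_fin]
  rw [← Nat.cast_smul_eq_nsmul ℝ, smul_smul, smul_smul]
  have hL0 : (P.L : ℝ) ≠ 0 := Nat.cast_ne_zero.mpr P.L_pos.ne'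
  have : ((P.L : ℝ) ^ (P.d + 1))⁻¹ * ((P.L ^ P.d : ℕ) : ℝ) * (P.L : ℝ) = 1 := by
    rw [Nat.cast_pow, pow_succ, mul_assoc, inv_mul_cancel₀ (by positivity)]
  rw [this, one_smul]

/-- Labels along the staircase `Γ_{y,x}` from the block CENTRE `emb y`: a forward step `t` of the `μ`-run starts at offset
`(L−1)/2 + t`. [folklore] -/
private theorem val_emb_add (hj : j + 1 ≤ P.m + P.K) (y : Site P (j + 1)) (μ : Fin P.d) (t : ℕ) (ht : (P.L - 1) / 2 + t < P.L) :
    ((emb y) μ + (t : ZMod (P.sitesPerDir j))).val = (y μ).val * P.L + ((P.L - 1) / 2 + t) := by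
  simp only [emb]
  rw [← Nat.cast_add, ZMod.val_natCast, Nat.mod_eq_of_lt]
  · ring
  · have hy : (y μ).val < P.sitesPerDir (j + 1) := ZMod.val_lt _
    rw [P.sitesPerDir_eq_mul_succ hj]
    calc (y μ).val * P.L + (P.L - 1) / 2 + t < (y μ).val * P.L + P.L := by omega
      _ = ((y μ).val + 1) * P.L := by ring
      _ ≤ P.sitesPerDir (j + 1) * P.L := Nat.mul_le_mul_right _ hy

/-- … and a backward step `t + 1` of the `μ`-run starts at offset `(L−1)/2 − (t+1)`. [folklore] -/
private theorem val_emb_sub (hj : j + 1 ≤ P.m + P.K) (y : Site P (j + 1)) (μ : Fin P.d) (t : ℕ) (ht : t + 1 ≤ (P.L - 1) / 2) :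
    ((emb y) μ - ((t + 1 : ℕ) : ZMod (P.sitesPerDir j))).val = (y μ).val * P.L + ((P.L - 1) / 2 - (t + 1)) := by
  simp only [emb]
  rw [← Nat.cast_sub (by omega), ZMod.val_natCast, Nat.mod_eq_of_lt]
  · omega
  · have hy : (y μ).val < P.sitesPerDir (j + 1) := ZMod.val_lt _
    rw [P.sitesPerDir_eq_mul_succ hj]
    calc (y μ).val * P.L + (P.L - 1) / 2 - (t + 1) < (y μ).val * P.L + P.L := by omega
      _ = ((y μ).val + 1) * P.L := by ring
      _ ≤ P.sitesPerDir (j + 1) * P.L := Nat.mul_le_mul_right _ hy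

/-- The signed length of the `μ`-run of `Γ_{emb y, x}`, `x = (y, r)`: `r_μ − (L−1)/2` (the least-absolute-value representative; no wrap-around
in the standing range). [folklore] -/
private theorem valMinAbs_blockSite_sub_emb (hj : j + 1 ≤ P.m + P.K) (y : Site P (j + 1)) (r : Fin P.d → Fin P.L) (μ : Fin P.d) :
    ((Site.blockSite y r) μ - (emb y) μ).valMinAbs = ((r μ : ℕ) : ℤ) - (((P.L - 1) / 2 : ℕ) : ℤ) := by
  rw [ZMod.valMinAbs_spec]
  have hr := (r μ).isLt
  have hL : 1 < P.L := P.hL.2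
  have h2L := two_mul_L_le_sitesPerDir (P := P) hj
  have hh : (P.L - 1) / 2 < P.L := by omega
  have h2 : 2 * (P.L : ℤ) ≤ (P.sitesPerDir j : ℤ) := by exact_mod_cast h2L
  refine ⟨?_, ?_, ?_⟩
  · have e1 : (Site.blockSite y r) μ = (((y μ).val * P.L + r μ : ℕ) : ZMod (P.sitesPerDir j)) := rfl
    have e2 : (emb y) μ = (((y μ).val * P.L + (P.L - 1) / 2 : ℕ) : ZMod (P.sitesPerDir j)) := rfl
    rw [e1, e2, Int.cast_sub, Int.cast_natCast, Int.cast_natCast, Nat.cast_add, Nat.cast_add, add_sub_add_left_eq_sub]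
  · have h1 : (((P.L - 1) / 2 : ℕ) : ℤ) < (P.L : ℤ) := by exact_mod_cast hh
    have h3 : (0 : ℤ) ≤ ((r μ : ℕ) : ℤ) := Int.natCast_nonneg _
    linarith
  · have h1 : ((r μ : ℕ) : ℤ) < (P.L : ℤ) := by exact_mod_cast hr
    have h3 : (0 : ℤ) ≤ (((P.L - 1) / 2 : ℕ) : ℤ) := Int.natCast_nonneg _
    linarith

/-- **`faceField B` IS AXIAL**: `(faceField B)(Γ_{y,x}) = 0` for every block point `x ∈ B(y)` — the staircase from the block centre to `x`
runs at offsets between `0` and `L − 2` in the direction of each of its runs, so it contains no far-face bond.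
[cite: Balaban1984PropagatorsI, (1.10) p.19] -/
theorem isAxial_faceField (hj : j + 1 ≤ P.m + P.K) (B : VecField P (j + 1) V) : IsAxial (faceField B) := by
  rw [isAxial_iff_forall]
  intro y r
  unfold stairSum
  refine Finset.sum_eq_zero fun μ _ => ?_
  have hL : Odd P.L ∧ 1 < P.L := P.hL
  obtain ⟨k, hk⟩ := hL.1
  have hh : (P.L - 1) / 2 = k := by omega
  have hz : mixSite μ (emb y) (Site.blockSite y r) μ = (emb y) μ := by simp [mixSite]
  rw [valMinAbs_blockSite_sub_emb hj]
  have hr := (r μ).isLt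
  rcases le_or_gt ((P.L - 1) / 2) (r μ : ℕ) with hle | hgt
  · -- forward run of `r_μ − (L−1)/2` steps, offsets `(L−1)/2, …, r_μ − 1 ≤ L − 2`
    obtain ⟨n, hn⟩ : ∃ n : ℕ, (r μ : ℕ) = (P.L - 1) / 2 + n := ⟨(r μ : ℕ) - (P.L - 1) / 2, by omega⟩
    have hcast : ((r μ : ℕ) : ℤ) - (((P.L - 1) / 2 : ℕ) : ℤ) = ((n : ℕ) : ℤ) := by rw [hn]; push_cast; ring
    rw [hcast, runSum_ofNat, segSum]
    refine Finset.sum_eq_zero fun t ht => ?_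
    rw [Finset.mem_range] at ht
    apply faceField_of_ne
    have hlt : (P.L - 1) / 2 + t < P.L := by omega
    simp only [runSite, Function.update_self, hz]
    rw [val_emb_add hj y μ t hlt, add_comm ((y μ).val * P.L), Nat.add_mul_mod_self_right, Nat.mod_eq_of_lt hlt]
    omega
  · -- backward run of `(L−1)/2 − r_μ` steps, offsets `(L−1)/2 − 1, …, r_μ ≥ 0`
    obtain ⟨n, hn⟩ : ∃ n : ℕ, (P.L - 1) / 2 = (r μ : ℕ) + (n + 1) := ⟨(P.L - 1) / 2 - (r μ : ℕ) - 1, by omega⟩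
    have hcast : ((r μ : ℕ) : ℤ) - (((P.L - 1) / 2 : ℕ) : ℤ) = Int.negSucc n := by
      rw [hn, Int.negSucc_eq]; push_cast; ring
    rw [hcast]
    show -(∑ t ∈ Finset.range (n + 1),
      faceField B ⟨Function.update (mixSite μ (emb y) (Site.blockSite y r)) μ
        (mixSite μ (emb y) (Site.blockSite y r) μ - ((t + 1 : ℕ) : ZMod (P.sitesPerDir j))), μ⟩) = 0
    rw [neg_eq_zero]
    refine Finset.sum_eq_zero fun t ht => ?_
    rw [Finset.mem_range] at ht
    apply faceField_of_ne
    have hle' : t + 1 ≤ (P.L - 1) / 2 := by omega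
    simp only [Function.update_self, hz]
    rw [val_emb_sub hj y μ t hle', add_comm ((y μ).val * P.L), Nat.add_mul_mod_self_right, Nat.mod_eq_of_lt (by omega)]
    omega

/-- **The fibre of `δ(B − QA)δ_Ax(A)` is never empty**: `faceField B ∈ fibre B` for every coarse field `B`.
[cite: Balaban1984PropagatorsI, (1.12) p.19] -/
theorem faceField_mem_fibre (hj : j + 1 ≤ P.m + P.K) (B : VecField P (j + 1) V) : faceField B ∈ fibre B :=
  ⟨isAxial_faceField hj B, bondAvg_faceField hj B⟩

/-- The fibre over `B` is the translate `faceField B + axialKer` of the constraint subspace.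
[cite: Balaban1984PropagatorsI, (1.12) p.19] -/
theorem mem_fibre_iff (hj : j + 1 ≤ P.m + P.K) (B : VecField P (j + 1) V) (A : VecField P j V) :
    A ∈ fibre B ↔ A - faceField B ∈ axialKer P j V :=
  mem_fibre_iff_sub_mem (faceField_mem_fibre hj B) A

end Representative

/-! ## 3. (1.12): the renormalization transformation as the integral over the fibre -/

section Integral

variable {P : Params} {j : ℕ}

/-- The dimension of the constraint subspace `{QA = 0, A(Γ_{y,x}) = 0}` (the number of integration variables left by the δ-functions
of (1.12)). [cite: Balaban1984PropagatorsI, (1.12) p.19] -/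
noncomputable def kerDim (P : Params) (j : ℕ) : ℕ := Module.finrank ℝ (axialKer P j ℝ)

/-- A basis matrix of the constraint subspace (columns = a basis of `axialKer`, as bond fields), the coordinates in which the fibre
integral is written; any other basis gives the same integral (`renormTransf_eq_subInt`). [cite: Balaban1984PropagatorsI, (1.12) p.19] -/
noncomputable def kerBasisMatrix (P : Params) (j : ℕ) : Matrix (PBond P j) (Fin (kerDim P j)) ℝ :=
  Matrix.of fun b i => ((Module.finBasis ℝ (axialKer P j ℝ) i : axialKer P j ℝ) : VecField P j ℝ) b

/-- `N z = Σ_i z_i e_i` — the basis matrix parametrises the constraint subspace by its coordinates. [folklore] -/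
private theorem kerBasisMatrix_mulVec (z : Fin (kerDim P j) → ℝ) :
    kerBasisMatrix P j *ᵥ z
      = (((Module.finBasis ℝ (axialKer P j ℝ)).equivFun.symm z : axialKer P j ℝ) : VecField P j ℝ) := by
  funext b
  simp only [kerBasisMatrix, mulVec, dotProduct, Matrix.of_apply, Module.Basis.equivFun_symm_apply, Submodule.coe_sum,
    Submodule.coe_smul, Finset.sum_apply, Pi.smul_apply, smul_eq_mul]
  exact Finset.sum_congr rfl fun i _ => mul_comm _ _

/-- `kerBasisMatrix` IS a basis matrix of the constraint subspace (injective, onto `axialKer`). [cite: Balaban1984PropagatorsI, (1.12) p.19] -/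
theorem isBasisOf_kerBasisMatrix : IsBasisOf (kerBasisMatrix P j) (axialKer P j ℝ : Set (VecField P j ℝ)) where
  inj := by
    intro z w h
    have h' : kerBasisMatrix P j *ᵥ z = kerBasisMatrix P j *ᵥ w := h
    rw [kerBasisMatrix_mulVec, kerBasisMatrix_mulVec] at h'
    exact (Module.finBasis ℝ (axialKer P j ℝ)).equivFun.symm.injective (Subtype.ext h')
  range_eq := by
    ext A
    constructor
    · rintro ⟨z, rfl⟩
      show kerBasisMatrix P j *ᵥ z ∈ (axialKer P j ℝ : Set (VecField P j ℝ))
      rw [kerBasisMatrix_mulVec]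
      exact SetLike.coe_mem _
    · intro hA
      refine ⟨(Module.finBasis ℝ (axialKer P j ℝ)).equivFun ⟨A, hA⟩, ?_⟩
      show kerBasisMatrix P j *ᵥ _ = A
      rw [kerBasisMatrix_mulVec, LinearEquiv.symm_apply_apply]

/-- **(1.12)** p. 19 [PDF 3], verbatim: *"then the renormalization transformation `T` is defined by
`(Te^{−S})(B) = ∫dA δ(B − QA)δ_Ax(A)e^{−S(A)}`. (1.12)"* — typed reading (measure level): the δ-functions restrict `dA` to the affine
fibre `{A axial, QA = B} = faceField B + axialKer`, and `(Te^{−S})(B)` is the Lebesgue (surface-measure) integral of `e^{−S}` over it,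
`B9Eq3166.subInt` in the basis `kerBasisMatrix` (= `√det(NᵀN)·∫ e^{−S(faceField B + Nz)}dz`); the print's normalisation of the product of
δ's differs by a constant depending on `d`, `L`, `|T|` only (inside `Z^{(0)}` of (1.14)). [cite: Balaban1984PropagatorsI, (1.12) p.19] -/
noncomputable def renormTransf (S : VecField P j ℝ → ℝ) (B : VecField P (j + 1) ℝ) : ℝ :=
  subInt (kerBasisMatrix P j) (fun A' => Real.exp (-S (faceField B + A')))

/-- BASIS INDEPENDENCE: (1.12) computed in ANY basis matrix of the constraint subspace gives the same number (the fibre integral is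
intrinsic; `B9Eq3170.subInt_eq_of_isBasisOf`). [cite: Balaban1984PropagatorsI, (1.12) p.19] -/
theorem renormTransf_eq_subInt {N : Matrix (PBond P j) (Fin (kerDim P j)) ℝ}
    (hN : IsBasisOf N (axialKer P j ℝ : Set (VecField P j ℝ))) (S : VecField P j ℝ → ℝ) (B : VecField P (j + 1) ℝ) :
    renormTransf S B = subInt N (fun A' => Real.exp (-S (faceField B + A'))) :=
  subInt_eq_of_isBasisOf isBasisOf_kerBasisMatrix hN _

/-- REPRESENTATIVE INDEPENDENCE: the fibre integral (1.12) may be based at ANY point `A₀` of the fibre `{A axial, QA = B}`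
(`A₀ − faceField B` lies in the constraint subspace and Lebesgue measure is translation invariant).
[cite: Balaban1984PropagatorsI, (1.12) p.19] -/
theorem renormTransf_eq_of_mem_fibre (hj : j + 1 ≤ P.m + P.K) (S : VecField P j ℝ → ℝ) {B : VecField P (j + 1) ℝ}
    {A₀ : VecField P j ℝ} (h₀ : A₀ ∈ fibre B) :
    renormTransf S B = subInt (kerBasisMatrix P j) (fun A' => Real.exp (-S (A₀ + A'))) := by
  have hmem : A₀ - faceField B ∈ (axialKer P j ℝ : Set (VecField P j ℝ)) := (mem_fibre_iff hj B A₀).mp h₀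
  obtain ⟨z₀, hz₀⟩ := (isBasisOf_kerBasisMatrix.mem_iff _).mp hmem
  unfold renormTransf subInt
  congr 1
  have hfun : (fun z : Fin (kerDim P j) → ℝ => Real.exp (-S (A₀ + kerBasisMatrix P j *ᵥ z)))
      = fun z => Real.exp (-S (faceField B + kerBasisMatrix P j *ᵥ (z₀ + z))) := by
    funext z
    rw [mulVec_add, hz₀]
    congr 3
    abel
  rw [hfun]
  exact (integral_add_left_eq_self (μ := volume)
    (fun z : Fin (kerDim P j) → ℝ => Real.exp (-S (faceField B + kerBasisMatrix P j *ᵥ z))) z₀).symm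

end Integral

/-! ## 4. (1.15): gauge covariance of the renormalization transformation under block-constant gauge functions -/

section Covariance

variable {P : Params} {j : ℕ} {V : Type*}

/-- "defining `λ` on `T₁` as constant on each block, `λ(x) = λ₁(y)` for `x ∈ B(y)`" (p. 19, before (1.15)): the block-constant extension of
a coarse gauge function. [cite: Balaban1984PropagatorsI, (1.15) p.19] -/
def blockConst (lam₁ : SiteField P (j + 1) V) : SiteField P j V := fun x => lam₁ (blockOf x)

/-- `λ(x) = λ₁(y)` at the block points `x ∈ B(y)`. [cite: Balaban1984PropagatorsI, (1.15) p.19] -/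
theorem blockConst_blockSite (hj : j + 1 ≤ P.m + P.K) (lam₁ : SiteField P (j + 1) V) (y : Site P (j + 1))
    (r : Fin P.d → Fin P.L) : blockConst lam₁ (Site.blockSite y r) = lam₁ y := by
  simp only [blockConst, Site.blockOf_blockSite hj]

/-- `λ(y) = λ₁(y)` at the block centres. [cite: Balaban1984PropagatorsI, (1.15) p.19] -/
theorem blockConst_emb (hj : j + 1 ≤ P.m + P.K) (lam₁ : SiteField P (j + 1) V) (y : Site P (j + 1)) :
    blockConst lam₁ (emb y) = lam₁ y := by
  simp only [blockConst, Site.blockOf_emb hj]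

variable [AddCommGroup V] [Module ℝ V]

/-- `Q′λ = λ₁` for the block-constant `λ` ((1.13) with "λ(x) = λ₁(y) for x ∈ B(y)", whence `∂Q′λ = ∂λ₁` in (1.15)).
[cite: Balaban1984PropagatorsI, (1.15) p.19] -/
theorem siteAvg_blockConst (hj : j + 1 ≤ P.m + P.K) (lam₁ : SiteField P (j + 1) V) : siteAvg (blockConst lam₁) = lam₁ :=
  siteAvg_comp_blockOf hj lam₁

/-- `δ_Ax(A^λ) = δ_Ax(A)` for block-constant `λ` (the middle step of (1.15)): `A^λ(Γ_{y,x}) = A(Γ_{y,x}) − c(λ(x) − λ(y)) = A(Γ_{y,x})`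
since `x` and the centre `y` lie in the same block. [cite: Balaban1984PropagatorsI, (1.15) p.19] -/
theorem isAxial_gaugeShift_blockConst (hj : j + 1 ≤ P.m + P.K) (c : ℝ) (lam₁ : SiteField P (j + 1) V) (A : VecField P j V) :
    IsAxial (gaugeShift c (blockConst lam₁) A) ↔ IsAxial A := by
  have h : ∀ (y : Site P (j + 1)) (r : Fin P.d → Fin P.L),
      stairSum (gaugeShift c (blockConst lam₁) A) (emb y) (Site.blockSite y r) = stairSum A (emb y) (Site.blockSite y r) := by
    intro y r
    rw [show gaugeShift c (blockConst lam₁) A = fun b => A b - grad c (blockConst lam₁) b from rfl,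
      B5Eq120IterProof.stairSum_sub, B5Eq120IterProof.stairSum_grad, blockConst_blockSite hj, blockConst_emb hj, sub_self,
      smul_zero, sub_zero]
  rw [isAxial_iff_forall, isAxial_iff_forall]
  simp only [h]

/-- `Q(A^λ) = QA − ∂λ₁ = B^{λ₁}` for block-constant `λ` ((1.13) with `Q′λ = λ₁`; the coarse gradient carries the lattice factor `c/L`,
(1.9) "`B^λ_c = B_c − L⁻¹(λ(c₊) − λ(c₋))`"). [cite: Balaban1984PropagatorsI, (1.13) p.19] -/
theorem bondAvg_gaugeShift_blockConst (hj : j + 1 ≤ P.m + P.K) (c : ℝ) (lam₁ : SiteField P (j + 1) V) (A : VecField P j V) :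
    bondAvg (gaugeShift c (blockConst lam₁) A) = gaugeShift (c / P.L) lam₁ (bondAvg A) := by
  rw [bondAvg_gaugeShift hj, siteAvg_blockConst hj]

/-- The change of variables of (1.15): `A ↦ A^λ` (block-constant `λ`) maps the fibre over `B` onto the fibre over `B^{λ₁} = B − ∂λ₁`.
[cite: Balaban1984PropagatorsI, (1.15) p.19] -/
theorem gaugeShift_mem_fibre (hj : j + 1 ≤ P.m + P.K) (c : ℝ) (lam₁ : SiteField P (j + 1) V) {B : VecField P (j + 1) V}
    {A : VecField P j V} (hA : A ∈ fibre B) :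
    gaugeShift c (blockConst lam₁) A ∈ fibre (gaugeShift (c / P.L) lam₁ B) :=
  ⟨(isAxial_gaugeShift_blockConst hj c lam₁ A).mpr hA.1, by rw [bondAvg_gaugeShift_blockConst hj, hA.2]⟩

/-- **(1.15), the integral step** p. 19 [PDF 3]: *"If `λ₁` is a gauge transformation on `T_L^{(1)}`, then defining `λ` on `T₁` as constant on
each block, `λ(x) = λ₁(y)` for `x ∈ B(y)`, we have `… = ∫dA δ(B^{λ₁} − QA^λ)δ_Ax(A^λ)exp(−S(A^λ)) = ∫dA δ(B − ∂λ₁ − QA + ∂Q′λ)δ_Ax(A)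
exp(−S(A)) = …`"* — typed reading: for every density `S` invariant under the gauge transformations (1.4) `A ↦ A − ∂λ` and every coarse
`λ₁`, `(Te^{−S})(B^{λ₁}) = (Te^{−S})(B)`, `B^{λ₁} = B − ∂λ₁` with the coarse lattice factor `c/L`; proof = the printed change of variables
(`gaugeShift_mem_fibre`, `renormTransf_eq_of_mem_fibre`). This is the gauge invariance of the form `⟨B, Δ₁B⟩` that (1.14) defines.
[cite: Balaban1984PropagatorsI, (1.15) p.19] -/
theorem renormTransf_gaugeShift (hj : j + 1 ≤ P.m + P.K) {c : ℝ} {S : VecField P j ℝ → ℝ}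
    (hS : ∀ (lam : SiteField P j ℝ) (A : VecField P j ℝ), S (gaugeShift c lam A) = S A) (lam₁ : SiteField P (j + 1) ℝ)
    (B : VecField P (j + 1) ℝ) :
    renormTransf S (gaugeShift (c / P.L) lam₁ B) = renormTransf S B := by
  rw [renormTransf_eq_of_mem_fibre hj S (gaugeShift_mem_fibre hj c lam₁ (faceField_mem_fibre hj B)), renormTransf]
  congr 1
  funext A'
  have h : gaugeShift c (blockConst lam₁) (faceField B) + A' = gaugeShift c (blockConst lam₁) (faceField B + A') := by
    funext b
    simp only [gaugeShift, Pi.add_apply]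
    ring
  rw [h, hS]

/-- (1.15) for the abelian action (1.3)/(1.5) `S(A) = ½Σ_p w|(∂A)(p)|²` (gauge invariant by `curlAction_gaugeShift`):
`(Te^{−S})(B − ∂λ₁) = (Te^{−S})(B)`. [cite: Balaban1984PropagatorsI, (1.15) p.19] -/
theorem renormTransf_curlAction_gaugeShift (hj : j + 1 ≤ P.m + P.K) (w c : ℝ) (lam₁ : SiteField P (j + 1) ℝ)
    (B : VecField P (j + 1) ℝ) :
    renormTransf (curlAction w c) (gaugeShift (c / P.L) lam₁ B) = renormTransf (curlAction w c) B :=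
  renormTransf_gaugeShift hj (fun lam A => curlAction_gaugeShift w c c lam A) lam₁ B

end Covariance

end B5Eq112RenormTransf

end Literature.MathematicalPhysics.QuantumFieldTheory.Balaban1983to89
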